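import Mathlib.FieldTheory.PrimitiveElement
import Mathlib.Algebra.Polynomial.Lifts
import Mathlib.GroupTheory.GroupAction.FixingSubgroup
import Literature.NumberTheory.NumberFields.TotallyRealOrCM
import HarnessLib

/-!
# `Aut(ℂ/E)`, `E` totally real or CM, acts transitively on the embeddings of a number field
# above its maximal CM subfield (Patrikis's CM-descent lemma)

Topic `NumberTheory/NumberFields`; theorems only (no definitions, no named facts), sequel of
`TotallyRealOrCM.lean` (Patrikis 2019, §2: the totally real or CM number fields are "the number
fields on which complex conjugation is well-defined").

The Galois-theoretic core of S. Patrikis, *Variations on a theorem of Tate* (Mem. AMS 2019 =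
arXiv:1207.6724), proof of Prop. 2.4.7 (`cmdescent`; arXiv §3.2): for a number field `F` with
maximal CM subfield `F_cm` and a CM number field `E ⊂ ℂ`, "the collection of such `σ`
[`σ ∈ Aut(ℂ/E)`] acts transitively on the set of embeddings `F ↪ ℂ` lying above a fixed
`F ∩ (F̃)_cm = F_cm ↪ ℂ`" (footnote: `G = Gal(F̃/F_cm)` is generated by `H = Gal(F̃/F)` and the
normal subgroup `H' = Gal(F̃/F̃_cm)`, and `H'x = H'Hx = Gx` on `Hom_{F_cm}(F, ℂ)`).

* `Subfield.conj_comm_of_isTotallyReal_or_isCMField` — on a subfield `E ⊆ ℂ`, finite over `ℚ` and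
  totally real or CM, complex conjugation commutes with every automorphism of `ℂ`
  (`σ z̄ = \overline{σ z}`; converse of `Subfield.isTotallyReal_or_isCMField_of_conj_comm`);
* `isTotallyReal_or_isCMField_of_conj_comm_apply` — a number field `E` with ONE embedding
  `φ₀ : E → ℂ` along which conjugation commutes with `Aut(ℂ)` is totally real or CM (the form of
  `Subfield.isTotallyReal_or_isCMField_of_conj_comm` for an abstract field; needed for subfields
  `M ≤ F` seen through an embedding `ι` of `F`);
* `exists_algEquiv_apply_eq_of_forall_isCMField_or_isTotallyReal` — **transitivity**: if
  `E ⊆ ℂ` is finite over `ℚ` and totally real or CM, and two embeddings `ι ι' : F →+* ℂ` of a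
  number field agree on every subfield of `F` that is CM or totally real (equivalently on `F_cm`,
  their largest member), then `ι' = σ ∘ ι` for some `σ ∈ Aut(ℂ/E)`.

## The proof (inside `Aut(ℂ)`, replacing the printed linear-disjointness step)

Let `C₀ = {z ∈ ℂ : σ z̄ = \overline{σ z} for all σ ∈ Aut(ℂ)}` (a subfield, `Aut(ℂ)`-stable,
containing `E` by the first theorem; `C₀ ∩ ℚ̄` is the field `ℚ^{cm}`) and `Δ = Aut(ℂ/C₀)`, a
normal subgroup of `Aut(ℂ)` contained in `Aut(ℂ/E)` and containing every `g c g⁻¹ c`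
(`c` = conjugation), so that conversely the fixed points of `Δ` lie in `C₀`. Then
`M = ι⁻¹(C₀) ≤ F` is totally real or CM (second theorem), so `ι = ι'` on `M`; this `M` is
`F_cm`. Let `θ` be a primitive element of `F/ℚ` and `q = ∏_{ι₁ ∈ Δι} (X - ι₁ θ)` the orbit
polynomial of the (finite) `Δ`-orbit of `ι`. Its coefficients are fixed by `Δ` (hence lie in
`C₀`) and by `Aut(ℂ/ιF)` (which permutes `Δι` by normality; hence lie in `ιF`, the fixed field
of `Aut(ℂ/ιF)` being `ιF`, `Complex.mem_subfield_of_forall_ringEquiv`), i.e. `q ∈ ι(M)[X]`.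
Since `q(ιθ) = 0` and `ι' = ι` on `M`, also `q(ι'θ) = 0`: `ι'θ = ι₁θ` for some `ι₁ = δ ∘ ι`,
`δ ∈ Δ`, whence `ι' = δ ∘ ι`. (This is the footnote's `H'x = Gx`, with `H' ↔ Δ`, proved by the
orbit polynomial instead of by counting through `[F̃E : E] = [F̃ : F̃ ∩ E]`; Mathlib pin v4.32.0
has no convenient linear-disjointness statement for a Galois extension and an arbitrary one
inside `ℂ`, searched `lean search 'linearDisjoint.*Galois|finrank_sup'`.)

## References

* S. Patrikis, *Variations on a theorem of Tate*, Mem. Amer. Math. Soc. 258 (2019), no. 1238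
  (= arXiv:1207.6724), §2 (Notation) and proof of Prop. 2.4.7 (arXiv §3.2, Prop. `cmdescent`).
  [Patrikis2019]
* S. Lang, *Algebra*, rev. 3rd ed., GTM 211 (2002), Ch. V §2, Ch. VIII §1. [Lang2002]
-/

noncomputable section

namespace Literature.NumberTheory.NumberFields

open NumberField NumberField.ComplexEmbedding Polynomial
open scoped ComplexConjugate Cardinal Classical
open Literature.FieldTheory.AlgClosed

/-! ### Conjugation commutes with `Aut(ℂ)` on totally real or CM subfields -/

/-- **On a totally real or CM subfield of `ℂ`, complex conjugation commutes with `Aut(ℂ)`.** If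
`E ⊆ ℂ` is finite over `ℚ` and totally real or CM, then `σ z̄ = \overline{σ z}` for every
automorphism `σ` of `ℂ` and every `z ∈ E`: for `E` totally real both `E ⊆ ℂ` and `σ|_E` are
real embeddings; for `E` CM the complex conjugation `τ` of `E` satisfies `φ ∘ τ = conj ∘ φ` for
EVERY embedding `φ` (Mathlib `IsCMField.complexEmbedding_complexConj`), applied to `φ = incl`
and `φ = σ ∘ incl`. (Patrikis 2019, §2: on these fields "complex conjugation is well-defined,
independent of the choice of complex embedding".) [cite: Patrikis2019, §2 (Notation, arXiv:1207.6724)] -/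
theorem Subfield.conj_comm_of_isTotallyReal_or_isCMField (E : Subfield ℂ) [FiniteDimensional ℚ E]
    (hE : IsTotallyReal E ∨ IsCMField E) (σ : ℂ ≃+* ℂ) {z : ℂ} (hz : z ∈ E) :
    σ (conj z) = conj (σ z) := by
  haveI : NumberField E := { to_charZero := inferInstance, to_finiteDimensional := ‹_› }
  rcases hE with h | h
  · -- totally real: `z` and `σ z` are real
    have h1 : conj z = z :=
      RingHom.congr_fun (isReal_iff.mp (IsTotallyReal.complexEmbedding_isReal E.subtype)) ⟨z, hz⟩
    have h2 : conj (σ z) = σ z :=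
      RingHom.congr_fun (isReal_iff.mp
        (IsTotallyReal.complexEmbedding_isReal (σ.toRingHom.comp E.subtype))) ⟨z, hz⟩
    rw [h1, h2]
  · -- CM: both sides are `σ (τ z)` for the complex conjugation `τ` of `E`
    have h1 := IsCMField.complexEmbedding_complexConj E E.subtype ⟨z, hz⟩
    have h2 : σ ((IsCMField.complexConj E ⟨z, hz⟩ : E) : ℂ) = conj (σ z) :=
      IsCMField.complexEmbedding_complexConj E (σ.toRingHom.comp E.subtype) ⟨z, hz⟩
    rw [← h2]
    exact congrArg σ h1.symm

/-- **A number field along one embedding of which conjugation commutes with `Aut(ℂ)` is totally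
real or CM.** If `φ₀ : E → ℂ` satisfies `σ (\overline{φ₀ x}) = \overline{σ (φ₀ x)}` for all
automorphisms `σ` of `ℂ` and all `x`, then the countable subfield `φ₀(E)` is stable under
conjugation (`Subfield.conj_mem_of_conj_comm`), conjugation pulls back to a `ℚ`-automorphism `τ`
of `E`, and `τ` induces complex conjugation under EVERY embedding `φ : E → ℂ`, because
`φ ∘ φ₀⁻¹` is the restriction of an automorphism of `ℂ`
(`Complex.exists_ringEquiv_apply_eq_of_subfield`); conclude by
`isTotallyReal_or_isCMField_of_forall_isConj`. (Patrikis 2019, §2.) [cite: Patrikis2019, §2 (Notation, arXiv:1207.6724)] -/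
theorem isTotallyReal_or_isCMField_of_conj_comm_apply {E : Type} [Field E] [NumberField E]
    (φ₀ : E →+* ℂ) (hcomm : ∀ σ : ℂ ≃+* ℂ, ∀ x : E, σ (conj (φ₀ x)) = conj (σ (φ₀ x))) :
    IsTotallyReal E ∨ IsCMField E := by
  -- the image `E' = φ₀(E) ⊆ ℂ`: countable, and conjugation commutes with `Aut(ℂ)` on it
  set E' : Subfield ℂ := φ₀.fieldRange with hE'_def
  have hEc : #E ≤ ℵ₀ := (Algebra.IsAlgebraic.cardinalMk_le_max ℚ E).trans (by simp)
  have hE'c : #E' ≤ ℵ₀ :=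
    (Cardinal.mk_le_of_surjective φ₀.rangeRestrictField_bijective.2).trans hEc
  have hcomm' : ∀ σ : ℂ ≃+* ℂ, ∀ z ∈ E', σ (conj z) = conj (σ z) := by
    rintro σ z hz
    obtain ⟨x, rfl⟩ := RingHom.mem_fieldRange.mp hz
    exact hcomm σ x
  have hcE' : ∀ x : E, conj (φ₀ x) ∈ E' := fun x ↦
    Subfield.conj_mem_of_conj_comm E' hE'c hcomm' (φ₀.mem_fieldRange_self x)
  -- complex conjugation pulled back to `E` along `φ₀`
  let e : E ≃+* E' := φ₀.rangeRestrictFieldEquiv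
  let τf : E → E := fun x ↦ e.symm ⟨conj (φ₀ x), hcE' x⟩
  have hτ : ∀ x, φ₀ (τf x) = conj (φ₀ x) := fun x ↦
    φ₀.rangeRestrictFieldEquiv_apply_symm_apply ⟨conj (φ₀ x), hcE' x⟩
  have hττ : ∀ x, τf (τf x) = x := fun x ↦ φ₀.injective (by rw [hτ, hτ, Complex.conj_conj])
  let τr : E ≃+* E :=
    { toFun := τf
      invFun := τf
      left_inv := hττ
      right_inv := hττ
      map_mul' := fun x y ↦ φ₀.injective (by rw [hτ, map_mul, map_mul, map_mul, hτ, hτ])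
      map_add' := fun x y ↦ φ₀.injective (by rw [hτ, map_add, map_add, map_add, hτ, hτ]) }
  have hτr : ∀ x, φ₀ (τr x) = conj (φ₀ x) := hτ
  let τ : E ≃ₐ[ℚ] E := AlgEquiv.ofRingEquiv (f := τr) fun q ↦ φ₀.injective (by
    rw [hτr]
    simp)
  refine isTotallyReal_or_isCMField_of_forall_isConj τ fun φ ↦ ?_
  -- every embedding `φ` of `E` is `g ∘ φ₀` for an automorphism `g` of `ℂ`
  obtain ⟨g, hg⟩ :=
    Complex.exists_ringEquiv_apply_eq_of_subfield E' hE'c (φ.comp e.symm.toRingHom)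
  have hgφ : ∀ x : E, g (φ₀ x) = φ x := fun x ↦ by
    have h := hg (e x)
    have hex : ((e x : E') : ℂ) = φ₀ x := rfl
    rw [hex] at h
    simpa [e] using h
  refine RingHom.ext fun x ↦ ?_
  rw [conjugate_coe_eq, ← hgφ x, ← hcomm g x, ← hτr x, hgφ]
  rfl

/-! ### Transitivity of `Aut(ℂ/E)` on the embeddings above the maximal CM subfield -/

/-- **`Aut(ℂ/E)` acts transitively on the embeddings of `F` above `F_cm`** (Patrikis 2019, proof
of Prop. 2.4.7). Let `E ⊆ ℂ` be a subfield, finite over `ℚ`, which is totally real or CM, and let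
`ι ι' : F → ℂ` be two embeddings of a number field `F` that agree on every subfield `M ≤ F` which
is CM or totally real (equivalently: on the maximal CM subfield `F_cm`, the largest such `M`).
Then there is a `ℚ`-algebra automorphism `σ` of `ℂ` fixing `E` pointwise with `σ (ι x) = ι' x`
for all `x ∈ F`. Printed: "we can find `σ ∈ Aut(ℂ/E)` restricting (via `ι̃`) to any element we
like of `Gal(F̃/(F̃)_cm)`; the collection of such `σ` acts transitively on the set of embeddings
`F ↪ ℂ` lying above a fixed `F ∩ (F̃)_cm = F_cm ↪ ℂ`". The proof here runs inside `Aut(ℂ)`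
with `Δ = Aut(ℂ/C₀) ≤ Aut(ℂ/E)`, `C₀ = {z : σ z̄ = \overline{σ z} ∀ σ}`, and the orbit
polynomial of `Δι` at a primitive element of `F` (module docstring); `F_cm` appears as
`ι⁻¹(C₀)`. [cite: Patrikis2019, Prop. 2.4.7, proof (Mem. AMS numbering; arXiv:1207.6724 §3.2, Prop. `cmdescent`)] -/
theorem exists_algEquiv_apply_eq_of_forall_isCMField_or_isTotallyReal
    {F : Type} [Field F] [NumberField F] (E : Subfield ℂ) [FiniteDimensional ℚ E]
    (hE : IsTotallyReal E ∨ IsCMField E) (ι ι' : F →+* ℂ)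
    (hιι' : ∀ M : Subfield F, (IsCMField M ∨ IsTotallyReal M) → ∀ x ∈ M, ι x = ι' x) :
    ∃ σ : ℂ ≃ₐ[ℚ] ℂ, (∀ z ∈ E, σ z = z) ∧ ∀ x, σ (ι x) = ι' x := by
  -- ring automorphisms of `ℂ` are `ℚ`-algebra automorphisms
  have toAlg : ∀ σ : ℂ ≃+* ℂ, ∃ g : ℂ ≃ₐ[ℚ] ℂ, ∀ z, g z = σ z := fun σ ↦
    ⟨AlgEquiv.ofRingEquiv (f := σ) fun q ↦ by simp, fun _ ↦ rfl⟩
  /- (1) The subfield `C₀` of `ℂ` where conjugation commutes with `Aut(ℂ)`; it contains `E` and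
  is `Aut(ℂ)`-stable. -/
  obtain ⟨C₀, hC₀⟩ : ∃ C₀ : Subfield ℂ, ∀ z, z ∈ C₀ ↔ ∀ g : ℂ ≃ₐ[ℚ] ℂ, g (conj z) = conj (g z) :=
    ⟨⨅ g : ℂ ≃ₐ[ℚ] ℂ, RingHom.eqLocusField ((g : ℂ →+* ℂ).comp (starRingEnd ℂ))
        ((starRingEnd ℂ).comp (g : ℂ →+* ℂ)),
      fun z ↦ by simp [Subfield.mem_iInf]⟩
  have hC₀E : ∀ z ∈ E, z ∈ C₀ := fun z hz ↦ (hC₀ z).mpr fun g ↦ by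
    simpa using Subfield.conj_comm_of_isTotallyReal_or_isCMField E hE (g : ℂ ≃+* ℂ) hz
  have hC₀g : ∀ z ∈ C₀, ∀ g : ℂ ≃ₐ[ℚ] ℂ, g z ∈ C₀ := fun z hz g ↦ (hC₀ _).mpr fun h ↦ by
    rw [← (hC₀ z).mp hz g, ← AlgEquiv.mul_apply, (hC₀ z).mp hz (h * g), AlgEquiv.mul_apply]
  /- (2) The normal subgroup `Δ = Aut(ℂ/C₀)` of `Aut(ℂ)`: it fixes `E`, contains the elements
  `g c g⁻¹ c` (`c` = complex conjugation), and its fixed points lie in `C₀`. -/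
  set Δ : Subgroup (ℂ ≃ₐ[ℚ] ℂ) := fixingSubgroup (ℂ ≃ₐ[ℚ] ℂ) (C₀ : Set ℂ) with hΔ_def
  have hΔ : ∀ δ, δ ∈ Δ ↔ ∀ z ∈ C₀, δ z = z := fun δ ↦ by
    simp [hΔ_def, mem_fixingSubgroup_iff, AlgEquiv.smul_def]
  have hΔE : ∀ δ ∈ Δ, ∀ z ∈ E, δ z = z := fun δ hδ z hz ↦ (hΔ δ).mp hδ z (hC₀E z hz)
  have hΔnormal : ∀ δ ∈ Δ, ∀ g : ℂ ≃ₐ[ℚ] ℂ, g * δ * g⁻¹ ∈ Δ := fun δ hδ g ↦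
    (hΔ _).mpr fun z hz ↦ by
      rw [AlgEquiv.mul_apply, AlgEquiv.mul_apply, (hΔ δ).mp hδ _ (hC₀g z hz g⁻¹),
        ← AlgEquiv.mul_apply, mul_inv_cancel, AlgEquiv.one_apply]
  set c : ℂ ≃ₐ[ℚ] ℂ := Complex.conjAe.restrictScalars ℚ with hc_def
  have hc : ∀ z, c z = conj z := fun _ ↦ rfl
  have hΔc : ∀ g : ℂ ≃ₐ[ℚ] ℂ, g * c * g⁻¹ * c ∈ Δ := fun g ↦ (hΔ _).mpr fun z hz ↦ by
    rw [AlgEquiv.mul_apply, AlgEquiv.mul_apply, AlgEquiv.mul_apply, hc, hc,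
      (hC₀ z).mp hz g⁻¹, Complex.conj_conj, ← AlgEquiv.mul_apply, mul_inv_cancel,
      AlgEquiv.one_apply]
  have hC₀fix : ∀ w, (∀ δ ∈ Δ, δ w = w) → w ∈ C₀ := fun w hw ↦ (hC₀ w).mpr fun g ↦ by
    have e := hw _ (hΔc g⁻¹)
    rw [inv_inv, AlgEquiv.mul_apply, AlgEquiv.mul_apply, AlgEquiv.mul_apply, hc, hc,
      AlgEquiv.aut_inv, AlgEquiv.symm_apply_eq] at e
    -- `e : conj (g (conj w)) = g w`
    have e2 := congrArg conj e
    rwa [Complex.conj_conj] at e2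
  /- (3) The subfield `M = ι⁻¹(C₀)` of `F` (this is `F_cm`) is totally real or CM, so `ι = ι'`
  on `M`. -/
  set M : Subfield F := C₀.comap ι with hM_def
  have hM : ∀ x, x ∈ M ↔ ι x ∈ C₀ := fun x ↦ Subfield.mem_comap
  have hMcm : IsTotallyReal M ∨ IsCMField M := by
    refine isTotallyReal_or_isCMField_of_conj_comm_apply (ι.comp M.subtype) fun σ x ↦ ?_
    obtain ⟨g, hg⟩ := toAlg σ
    have hx := (hC₀ _).mp ((hM x).mp x.2) g
    simpa [hg] using hx
  have hιM : ∀ x ∈ M, ι x = ι' x := hιι' M hMcm.symm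
  /- (4) The `Δ`-orbit `B` of `ι` and its orbit polynomial `q` at a primitive element `θ`. -/
  let pb := Field.powerBasisOfFiniteOfSeparable ℚ F
  set B : Finset (F →+* ℂ) :=
    Finset.univ.filter fun ι₁ ↦ ∃ δ ∈ Δ, ι₁ = (δ : ℂ →+* ℂ).comp ι with hB_def
  have hmemB : ∀ ι₁, ι₁ ∈ B ↔ ∃ δ ∈ Δ, ι₁ = (δ : ℂ →+* ℂ).comp ι := fun ι₁ ↦ by
    simp [hB_def]
  have hιB : ι ∈ B := (hmemB ι).mpr ⟨1, Δ.one_mem, RingHom.ext fun _ ↦ rfl⟩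
  set q : ℂ[X] := ∏ ι₁ ∈ B, (X - C (ι₁ pb.gen)) with hq_def
  -- `q` is invariant under every automorphism of `ℂ` mapping `B` into itself
  have hqmap : ∀ g : ℂ ≃ₐ[ℚ] ℂ, (∀ ι₁ ∈ B, (g : ℂ →+* ℂ).comp ι₁ ∈ B) →
      q.map (g : ℂ →+* ℂ) = q := by
    intro g hg
    have hinj : Set.InjOn (fun ι₁ : F →+* ℂ ↦ (g : ℂ →+* ℂ).comp ι₁) ↑B :=
      fun ι₁ _ ι₂ _ h ↦ RingHom.ext fun x ↦ g.injective (RingHom.congr_fun h x :)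
    have himage : B.image (fun ι₁ : F →+* ℂ ↦ (g : ℂ →+* ℂ).comp ι₁) = B :=
      Finset.eq_of_subset_of_card_le (Finset.image_subset_iff.mpr hg)
        (Finset.card_image_of_injOn hinj).ge
    rw [hq_def, Polynomial.map_prod]
    conv_rhs => rw [← himage]
    rw [Finset.prod_image hinj]
    refine Finset.prod_congr rfl fun ι₁ _ ↦ ?_
    simp only [Polynomial.map_sub, Polynomial.map_X, Polynomial.map_C, RingHom.comp_apply]
  -- in particular under `Δ` …
  have hqΔ : ∀ δ ∈ Δ, q.map (δ : ℂ →+* ℂ) = q := fun δ hδ ↦ hqmap δ fun ι₁ hι₁ ↦ by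
    obtain ⟨δ', hδ', rfl⟩ := (hmemB ι₁).mp hι₁
    exact (hmemB _).mpr ⟨δ * δ', Δ.mul_mem hδ hδ', RingHom.ext fun _ ↦ rfl⟩
  -- … and under `Aut(ℂ/ιF)`, which permutes the orbit `B` because `Δ` is normal
  have hqτ : ∀ τ : ℂ ≃ₐ[ℚ] ℂ, (∀ x, τ (ι x) = ι x) → q.map (τ : ℂ →+* ℂ) = q :=
      fun τ hτ ↦ hqmap τ fun ι₁ hι₁ ↦ by
    obtain ⟨δ', hδ', rfl⟩ := (hmemB ι₁).mp hι₁
    refine (hmemB _).mpr ⟨τ * δ' * τ⁻¹, hΔnormal δ' hδ' τ, RingHom.ext fun x ↦ ?_⟩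
    have hτ' : τ⁻¹ (ι x) = ι x := by rw [AlgEquiv.aut_inv, AlgEquiv.symm_apply_eq, hτ]
    simp [AlgEquiv.mul_apply, hτ']
  /- (5) Hence the coefficients of `q` lie in `ιF ∩ C₀ = ι(M)`: `q ∈ ι(M)[X]`. -/
  have hFc : #F ≤ ℵ₀ := (Algebra.IsAlgebraic.cardinalMk_le_max ℚ F).trans (by simp)
  have hιFc : #ι.fieldRange ≤ ℵ₀ :=
    (Cardinal.mk_le_of_surjective ι.rangeRestrictField_bijective.2).trans hFc
  have hcoeff : ∀ k, ∃ m ∈ M, q.coeff k = ι m := by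
    intro k
    have h1 : q.coeff k ∈ ι.fieldRange := by
      refine Complex.mem_subfield_of_forall_ringEquiv ι.fieldRange hιFc fun σ hσ ↦ ?_
      obtain ⟨τ, hτ⟩ := toAlg σ
      have hτι : ∀ x, τ (ι x) = ι x := fun x ↦ (hτ _).trans (hσ _ (ι.mem_fieldRange_self x))
      have h := congrArg (fun p : ℂ[X] ↦ p.coeff k) (hqτ τ hτι)
      simpa [Polynomial.coeff_map, hτ] using h
    obtain ⟨m, hm⟩ := RingHom.mem_fieldRange.mp h1
    have h2 : q.coeff k ∈ C₀ := hC₀fix _ fun δ hδ ↦ by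
      have h := congrArg (fun p : ℂ[X] ↦ p.coeff k) (hqΔ δ hδ)
      simpa [Polynomial.coeff_map] using h
    refine ⟨m, ?_, hm.symm⟩
    rw [hM, hm]
    exact h2
  obtain ⟨Q, hQ⟩ : ∃ Q : M[X], Q.map (ι.comp M.subtype) = q := by
    rw [← Polynomial.mem_lifts, Polynomial.lifts_iff_coeff_lifts]
    intro k
    obtain ⟨m, hm, hk⟩ := hcoeff k
    exact ⟨⟨m, hm⟩, hk.symm⟩
  /- (6) `q(ιθ) = 0`, hence (coefficients in `M`, where `ι = ι'`) `q(ι'θ) = 0`: `ι'θ = ι₁θ` for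
  some `ι₁ ∈ Δι`, and `ι' = ι₁` since `θ` generates `F`. -/
  have hqι : q.eval (ι pb.gen) = 0 := by
    rw [hq_def, Polynomial.eval_prod]
    exact Finset.prod_eq_zero hιB (by simp)
  have hQθ : Q.eval₂ M.subtype pb.gen = 0 := by
    apply ι.injective
    rw [Polynomial.hom_eval₂, map_zero, ← Polynomial.eval_map, hQ, hqι]
  have hqι' : q.eval (ι' pb.gen) = 0 := by
    have hcomp : ι'.comp M.subtype = ι.comp M.subtype :=
      RingHom.ext fun x ↦ (hιM x x.2).symm
    rw [← hQ, Polynomial.eval_map, ← hcomp, ← Polynomial.hom_eval₂, hQθ, map_zero]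
  obtain ⟨ι₁, hι₁B, hι₁θ⟩ : ∃ ι₁ ∈ B, ι' pb.gen = ι₁ pb.gen := by
    rw [hq_def, Polynomial.eval_prod, Finset.prod_eq_zero_iff] at hqι'
    obtain ⟨ι₁, hι₁, h0⟩ := hqι'
    exact ⟨ι₁, hι₁, by simpa [sub_eq_zero] using h0⟩
  have hιeq : ι' = ι₁ := by
    have h : ι'.toRatAlgHom = ι₁.toRatAlgHom := pb.algHom_ext (by simpa using hι₁θ)
    have h' := congrArg AlgHom.toRingHom h
    simpa [RingHom.toRatAlgHom_toRingHom] using h'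
  obtain ⟨δ, hδ, rfl⟩ := (hmemB ι₁).mp hι₁B
  exact ⟨δ, hΔE δ hδ, fun x ↦ by rw [hιeq]; rfl⟩

end Literature.NumberTheory.NumberFields
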